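import Mathlib
import Literature.NumberTheory.LFunctions.Zhang2022.Section8LambdaZeroLocal
import Literature.NumberTheory.Sieve.CoprimeTotientLogSum
import HarnessLib

/-!
# Zhang (2022) §8 p. 48 — `λ₀ⱼ(n) = φ(n)²/n² + O(α𝓛)` (`Z22:§8.u047`, second equality), absolute
# and relative forms: discharge for `Section8cStatements.Step8u047` (L2-t8)

Topic `Literature/NumberTheory/LFunctions/Zhang2022` (Landau–Siegel audit tree; verdict-neutral).
Y. Zhang, arXiv:2211.02515v1 (2022) [Zhang2022LandauSiegel] — **an unrefereed manuscript under
adjudication** (D-0069 campaign, discharge seat d16). Continues `Section8LambdaZeroLocal`. PROVED: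

* `step8u047_holds : Step8u047 c′` — `Z22:§8.u047` (second equality, `α₁ ↦ α𝓛` as typed)
  DISCHARGED: for `1 ≤ n < P`, `‖λ₀ⱼ(n) − (φ(n)/n)²‖ ≤ 147420 · α𝓛`, by multiplicativity
  (`lamZero_eq_prod_primeFactors`, `φ(n)/n = ∏(1 − q⁻¹)`), the perturbation lemma
  `norm_prod_add_sub_prod_le` (`‖∏(m+r) − ∏m‖ ≤ ∏(1+‖r‖) − 1 ≤ e^{Σ‖r‖} − 1`) and
  `Σ_{q∣n} log q/q ≤ 351𝓛` for `n < P = e^{𝓛⁹}` (`sum_primeFactors_log_div_le`).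
* `norm_lamZero_sub_totient_sq_le_rel` — the RELATIVE form
  `‖λ₀ⱼ(n) − (φ(n)/n)²‖ ≤ 589680 · α𝓛 · (φ(n)/n)²` (`𝓛 ≥ 6`), i.e. `λ₀ⱼ(n)/φ(n) = (φ(n)/n²)(1 + O(α𝓛))`,
  the form consumed by the partial integration (8.11) (error weight `≪ α𝓛/n`).

(`Z22:§8.u048`, the `[T, 1.2.12]` mean value, is treated in `Section8TotientLogMean`.)

WHAT THIS IS NOT: any claim about Theorems 1–2 of the manuscript or about Landau–Siegel zeros.

## References

* Y. Zhang, arXiv:2211.02515v1 (2022), §8 p. 48, display before (8.11) (tex L2459); §7 p. 33.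
  [cite: Zhang2022LandauSiegel, §8 p.48]
-/

noncomputable section

open Complex Real ComplexConjugate Set

namespace Literature.NumberTheory.LFunctions.Zhang2022.Section8cProofs

open Literature.NumberTheory.LFunctions.Zhang2022.Skeleton

/-! ## Products: a perturbation lemma -/

/-- `‖∏(mᵢ + rᵢ) − ∏ mᵢ‖ ≤ ∏(1 + ‖rᵢ‖) − 1` when all `‖mᵢ‖ ≤ 1`. [folklore] -/
private theorem norm_prod_add_sub_prod_le {ι : Type*} (s : Finset ι) (m r : ι → ℂ)
    (hm : ∀ i ∈ s, ‖m i‖ ≤ 1) :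
    ‖∏ i ∈ s, (m i + r i) - ∏ i ∈ s, m i‖ ≤ ∏ i ∈ s, (1 + ‖r i‖) - 1 := by
  classical
  induction s using Finset.induction_on with
  | empty => simp
  | insert a s ha ih =>
    have hm' : ∀ i ∈ s, ‖m i‖ ≤ 1 := fun i hi => hm i (Finset.mem_insert_of_mem hi)
    have hma : ‖m a‖ ≤ 1 := hm a (Finset.mem_insert_self a s)
    have ih' := ih hm'
    rw [Finset.prod_insert ha, Finset.prod_insert ha, Finset.prod_insert ha]
    have hP : ‖∏ i ∈ s, (m i + r i)‖ ≤ ∏ i ∈ s, (1 + ‖r i‖) := by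
      rw [norm_prod]
      apply Finset.prod_le_prod (fun i _ => norm_nonneg _)
      intro i hi
      calc ‖m i + r i‖ ≤ ‖m i‖ + ‖r i‖ := norm_add_le _ _
        _ ≤ 1 + ‖r i‖ := by gcongr; exact hm' i hi
    have hPs : 1 ≤ ∏ i ∈ s, (1 + ‖r i‖) := by
      calc (1 : ℝ) = ∏ i ∈ s, (1 : ℝ) := by simp
        _ ≤ ∏ i ∈ s, (1 + ‖r i‖) := by
          apply Finset.prod_le_prod (fun i _ => zero_le_one)
          intro i _
          linarith [norm_nonneg (r i)]
    have hdec : (m a + r a) * ∏ i ∈ s, (m i + r i) - m a * ∏ i ∈ s, m i =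
        m a * (∏ i ∈ s, (m i + r i) - ∏ i ∈ s, m i) + r a * ∏ i ∈ s, (m i + r i) := by ring
    rw [hdec]
    calc ‖m a * (∏ i ∈ s, (m i + r i) - ∏ i ∈ s, m i) + r a * ∏ i ∈ s, (m i + r i)‖
        ≤ ‖m a * (∏ i ∈ s, (m i + r i) - ∏ i ∈ s, m i)‖ + ‖r a * ∏ i ∈ s, (m i + r i)‖ :=
          norm_add_le _ _
      _ = ‖m a‖ * ‖∏ i ∈ s, (m i + r i) - ∏ i ∈ s, m i‖ + ‖r a‖ * ‖∏ i ∈ s, (m i + r i)‖ := by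
          rw [norm_mul, norm_mul]
      _ ≤ 1 * (∏ i ∈ s, (1 + ‖r i‖) - 1) + ‖r a‖ * ∏ i ∈ s, (1 + ‖r i‖) := by
          gcongr
      _ = (1 + ‖r a‖) * ∏ i ∈ s, (1 + ‖r i‖) - 1 := by ring

/-- `∏(1 + eᵢ) ≤ exp(Σ eᵢ)` for `eᵢ ≥ 0`. [folklore] -/
private theorem prod_one_add_le_exp_sum {ι : Type*} (s : Finset ι) (e : ι → ℝ) (he : ∀ i ∈ s, 0 ≤ e i) :
    ∏ i ∈ s, (1 + e i) ≤ Real.exp (∑ i ∈ s, e i) := by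
  rw [Real.exp_sum]
  apply Finset.prod_le_prod
  · intro i hi; linarith [he i hi]
  · intro i _; linarith [Real.add_one_le_exp (e i)]


/-! ## The global factor `λ₀ⱼ(n)`: multiplicativity and `φ(n)/n` -/

/-- `λ₀ⱼ(n) = ∏_{q ∣ n} λ₀ⱼ(q)` (the definition of `λ` is a product over the prime factors). [cite: Zhang2022LandauSiegel, §7 p.33] -/
theorem lamZero_eq_prod_primeFactors (c' : ℝ) (D j n : ℕ) :
    lamZero c' D j n = ∏ q ∈ n.primeFactors, lamZero c' D j q := by
  unfold lamZero lam
  refine Finset.prod_congr rfl fun q hq => ?_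
  rw [Nat.Prime.primeFactors (Nat.prime_of_mem_primeFactors hq), Finset.prod_singleton]

/-- `(φ(n)/n)² = ∏_{q ∣ n} (1 − q⁻¹)²` over `ℂ`. [folklore] -/
private theorem totient_div_sq_eq_prod {n : ℕ} (hn : n ≠ 0) :
    ((Nat.totient n : ℂ) / (n : ℂ)) ^ 2 = ∏ q ∈ n.primeFactors, (1 - (q : ℂ)⁻¹) ^ 2 := by
  have h := Literature.NumberTheory.Sieve.CoprimeTotient.totient_div_eq_prod hn
  have h' : ((Nat.totient n : ℂ) / (n : ℂ)) = (((Nat.totient n : ℝ) / (n : ℝ) : ℝ) : ℂ) := by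
    push_cast; rfl
  rw [h', h]
  push_cast
  rw [← Finset.prod_pow]

/-! ## `Σ_{q ∣ n} log q / q ≪ 𝓛` for `n < P` -/

/-- `(log 𝓛)² ≤ 4𝓛` and `0 ≤ log 𝓛 ≤ 𝓛` for `𝓛 ≥ 1`. [folklore] -/
private theorem log_ell_bounds {L : ℝ} (hL : 1 ≤ L) :
    0 ≤ Real.log L ∧ Real.log L ≤ L ∧ Real.log L ^ 2 ≤ 4 * L := by
  have hL0 : 0 < L := by linarith
  have hlog0 : 0 ≤ Real.log L := Real.log_nonneg hL
  refine ⟨hlog0, by linarith [Real.log_le_sub_one_of_pos hL0], ?_⟩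
  have hs : 0 < Real.sqrt L := Real.sqrt_pos.mpr hL0
  have h1 : Real.log (Real.sqrt L) ≤ Real.sqrt L - 1 := Real.log_le_sub_one_of_pos hs
  have h2 : Real.log L = 2 * Real.log (Real.sqrt L) := by
    rw [Real.log_sqrt hL0.le]; ring
  have hsq : Real.sqrt L ^ 2 = L := Real.sq_sqrt hL0.le
  have h4 : Real.log L ≤ 2 * Real.sqrt L := by rw [h2]; linarith
  nlinarith

/-- For `1 ≤ n < P` and `𝓛 ≥ 5`: `Σ_{q ∣ n} (log q)/q ≤ 351 𝓛` (split at `q ≤ log P = 𝓛⁹`: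
harmonic bound below, `ω(n) ≤ log₂ n < 𝓛⁹/log 2` terms of size `≤ log(𝓛⁹)/𝓛⁹` above). [cite: Zhang2022LandauSiegel, §8 p.48 display before (8.11), tex L2459] -/
theorem sum_primeFactors_log_div_le {D n : ℕ} (hL : 5 ≤ ell D) (hn : 1 ≤ n)
    (hnP : (n : ℝ) < bigP D) :
    ∑ q ∈ n.primeFactors, Real.log q / q ≤ 351 * ell D := by
  set y : ℝ := ell D ^ 9 with hy
  have hL1 : 1 ≤ ell D := by linarith
  have hL0 : 0 < ell D := by linarith
  obtain ⟨hu0, hu1, hu2⟩ := log_ell_bounds hL1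
  have hy1 : ell D ≤ y := by
    calc ell D = ell D ^ 1 := (pow_one _).symm
      _ ≤ ell D ^ 9 := pow_le_pow_right₀ hL1 (by norm_num)
  have hy5 : 5 ≤ y := le_trans hL hy1
  have hy0 : 0 < y := by linarith
  have hye : Real.exp 1 ≤ y := by
    have := Real.exp_one_lt_d9; linarith
  have hlogy : Real.log y = 9 * Real.log (ell D) := by rw [hy, Real.log_pow]; norm_num
  have hlogy0 : 0 ≤ Real.log y := by rw [hlogy]; positivity
  have hn0 : n ≠ 0 := by omega
  have hnr : (0 : ℝ) < n := by exact_mod_cast hn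
  -- `log n < y`
  have hlogn : Real.log n < y := by
    have : Real.log n < Real.log (bigP D) := Real.log_lt_log hnr hnP
    rwa [bigP, Real.log_exp] at this
  have hlogn0 : 0 ≤ Real.log n := Real.log_natCast_nonneg n
  set S := n.primeFactors with hS
  rw [← Finset.sum_filter_add_sum_filter_not S (fun q : ℕ => (q : ℝ) ≤ y)]
  have hsmall : ∑ q ∈ S.filter (fun q : ℕ => (q : ℝ) ≤ y), Real.log q / q ≤
      Real.log y * (1 + Real.log y) := by
    have h1 : ∑ q ∈ S.filter (fun q : ℕ => (q : ℝ) ≤ y), Real.log q / q ≤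
        ∑ q ∈ S.filter (fun q : ℕ => (q : ℝ) ≤ y), Real.log y * ((1 : ℝ) / q) := by
      apply Finset.sum_le_sum
      intro q hq
      rw [Finset.mem_filter] at hq
      have hqp : q.Prime := Nat.prime_of_mem_primeFactors hq.1
      have hq0 : (0 : ℝ) < q := by exact_mod_cast hqp.pos
      rw [mul_one_div]
      apply div_le_div_of_nonneg_right _ hq0.le
      exact Real.log_le_log hq0 hq.2
    have h2 : ∑ q ∈ S.filter (fun q : ℕ => (q : ℝ) ≤ y), Real.log y * ((1 : ℝ) / q) =
        Real.log y * ∑ q ∈ S.filter (fun q : ℕ => (q : ℝ) ≤ y), (1 : ℝ) / q := by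
      rw [Finset.mul_sum]
    have h3 : ∑ q ∈ S.filter (fun q : ℕ => (q : ℝ) ≤ y), (1 : ℝ) / q ≤
        ∑ k ∈ Finset.Icc 1 ⌊y⌋₊, (1 : ℝ) / k := by
      apply Finset.sum_le_sum_of_subset_of_nonneg
      · intro q hq
        rw [Finset.mem_filter] at hq
        have hqp : q.Prime := Nat.prime_of_mem_primeFactors hq.1
        rw [Finset.mem_Icc]
        exact ⟨hqp.one_le, Nat.le_floor hq.2⟩
      · intro k _ _; positivity
    have h4 : ∑ k ∈ Finset.Icc 1 ⌊y⌋₊, (1 : ℝ) / k ≤ 1 + Real.log y := by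
      have := Literature.NumberTheory.Sieve.SquarefreeSums.abs_sum_inv_sub_log_le
        (y := y) (by linarith)
      rw [abs_le] at this
      linarith [this.2]
    calc _ ≤ _ := h1
      _ = _ := h2
      _ ≤ Real.log y * (1 + Real.log y) := by gcongr; exact le_trans h3 h4
  have hcard : (S.card : ℝ) * Real.log 2 ≤ Real.log n := by
    have h1 : 2 ^ S.card ≤ ∏ p ∈ S, p :=
      Finset.pow_card_le_prod S (fun p => p) 2 fun p hp => (Nat.prime_of_mem_primeFactors hp).two_le
    have h2 : ∏ p ∈ S, p ≤ n := Nat.le_of_dvd (by omega) (Nat.prod_primeFactors_dvd n)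
    have h3 : (2 : ℝ) ^ S.card ≤ n := by exact_mod_cast h1.trans h2
    have h4 : Real.log ((2 : ℝ) ^ S.card) ≤ Real.log n :=
      Real.log_le_log (by positivity) h3
    rw [Real.log_pow] at h4
    linarith
  have hlarge : ∑ q ∈ S.filter (fun q : ℕ => ¬ (q : ℝ) ≤ y), Real.log q / q ≤ 2 * Real.log y := by
    have h1 : ∑ q ∈ S.filter (fun q : ℕ => ¬ (q : ℝ) ≤ y), Real.log q / q ≤
        ∑ q ∈ S.filter (fun q : ℕ => ¬ (q : ℝ) ≤ y), Real.log y / y := by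
      apply Finset.sum_le_sum
      intro q hq
      rw [Finset.mem_filter, not_le] at hq
      have hqe : Real.exp 1 ≤ (q : ℝ) := le_trans hye hq.2.le
      exact Real.log_div_self_antitoneOn hye hqe hq.2.le
    have h2 : ∑ q ∈ S.filter (fun q : ℕ => ¬ (q : ℝ) ≤ y), Real.log y / y =
        (S.filter (fun q : ℕ => ¬ (q : ℝ) ≤ y)).card * (Real.log y / y) := by
      rw [Finset.sum_const, nsmul_eq_mul]
    have h3 : ((S.filter (fun q : ℕ => ¬ (q : ℝ) ≤ y)).card : ℝ) ≤ S.card := by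
      exact_mod_cast Finset.card_filter_le _ _
    have hlog2 : (1 : ℝ) / 2 ≤ Real.log 2 := by
      have := Real.log_two_gt_d9; linarith
    have h4 : (S.card : ℝ) ≤ 2 * y := by
      have : (S.card : ℝ) * (1 / 2) ≤ y := by
        calc (S.card : ℝ) * (1 / 2) ≤ S.card * Real.log 2 := by gcongr
          _ ≤ Real.log n := hcard
          _ ≤ y := hlogn.le
      linarith
    have hyy : 0 ≤ Real.log y / y := by positivity
    calc _ ≤ _ := h1
      _ = _ := h2
      _ ≤ (S.card : ℝ) * (Real.log y / y) := by gcongr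
      _ ≤ (2 * y) * (Real.log y / y) := by gcongr
      _ = 2 * Real.log y := by field_simp
  calc _ ≤ Real.log y * (1 + Real.log y) + 2 * Real.log y := add_le_add hsmall hlarge
    _ = 27 * Real.log (ell D) + 81 * Real.log (ell D) ^ 2 := by rw [hlogy]; ring
    _ ≤ 27 * ell D + 81 * (4 * ell D) := by gcongr
    _ = 351 * ell D := by ring


/-! ## The global factor: `λ₀ⱼ(n) = φ(n)²/n² + O(α𝓛)` -/

/-- **Pointwise form of `Z22:§8.u047` (global)**: for `|c′|α𝓛 ≤ 1`, `𝓛 ≥ 5`, `1 ≤ n < P` and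
any `j`, `‖λ₀ⱼ(n) − (φ(n)/n)²‖ ≤ 147420 · α𝓛`. [cite: Zhang2022LandauSiegel, §8 p.48 display before (8.11), tex L2459] -/
theorem norm_lamZero_sub_totient_sq_le {c' : ℝ} {D n : ℕ} (h : |c'| * alpha D * ell D ≤ 1)
    (hL : 5 ≤ ell D) (hn : 1 ≤ n) (hnP : (n : ℝ) < bigP D) (j : ℕ) :
    ‖lamZero c' D j n - ((Nat.totient n : ℂ) / (n : ℂ)) ^ 2‖ ≤ 147420 * (alpha D * ell D) := by
  have hα : alpha D = π / ell D ^ 9 := by rw [alpha, bigP, Real.log_exp]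
  have hL0 : 0 < ell D := by linarith
  have hαpos : 0 < alpha D := by rw [hα]; positivity
  have hℓ : 0 ≤ ell D := hL0.le
  rw [lamZero_eq_prod_primeFactors, totient_div_sq_eq_prod (by omega : n ≠ 0)]
  set S := n.primeFactors with hS
  set m : ℕ → ℂ := fun q => (1 - (q : ℂ)⁻¹) ^ 2 with hm
  set r : ℕ → ℂ := fun q => lamZero c' D j q - (1 - (q : ℂ)⁻¹) ^ 2 with hr
  have hm1 : ∀ q ∈ S, ‖m q‖ ≤ 1 := by
    intro q hq
    have hqp : q.Prime := Nat.prime_of_mem_primeFactors hq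
    have hq0 : (0 : ℝ) < q := by exact_mod_cast hqp.pos
    have hq1 : (1 : ℝ) ≤ q := by exact_mod_cast hqp.one_le
    have hcast : m q = (((1 - (q : ℝ)⁻¹) ^ 2 : ℝ) : ℂ) := by rw [hm]; push_cast; rfl
    rw [hcast, Complex.norm_real, Real.norm_eq_abs, abs_pow, abs_of_nonneg]
    · have : (1 - (q : ℝ)⁻¹) ≤ 1 := by
        have : (0 : ℝ) ≤ (q : ℝ)⁻¹ := by positivity
        linarith
      have h0 : 0 ≤ (1 - (q : ℝ)⁻¹) := by
        rw [sub_nonneg]; exact inv_le_one_of_one_le₀ hq1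
      calc (1 - (q : ℝ)⁻¹) ^ 2 ≤ 1 ^ 2 := by gcongr
        _ = 1 := by norm_num
    · rw [sub_nonneg]; exact inv_le_one_of_one_le₀ hq1
  have key := norm_prod_add_sub_prod_le S m r hm1
  have hmr : ∏ q ∈ S, (m q + r q) = ∏ q ∈ S, lamZero c' D j q :=
    Finset.prod_congr rfl fun q _ => by rw [hm, hr]; ring
  rw [hmr] at key
  -- the size of the perturbation
  have hrq : ∀ q ∈ S, ‖r q‖ ≤ 210 * (alpha D * Real.log q / q) := fun q hq =>
    norm_lamZero_prime_sub_le h hαpos.le hℓ j (Nat.prime_of_mem_primeFactors hq)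
  have hB := sum_primeFactors_log_div_le hL hn hnP
  set X : ℝ := ∑ q ∈ S, ‖r q‖ with hX
  have hX0 : 0 ≤ X := Finset.sum_nonneg fun q _ => norm_nonneg _
  have hXle : X ≤ 210 * 351 * (alpha D * ell D) := by
    calc X ≤ ∑ q ∈ S, 210 * (alpha D * Real.log q / q) := Finset.sum_le_sum hrq
      _ = 210 * alpha D * ∑ q ∈ S, Real.log q / q := by
          rw [Finset.mul_sum]
          refine Finset.sum_congr rfl fun q _ => ?_
          ring
      _ ≤ 210 * alpha D * (351 * ell D) := by gcongr
      _ = 210 * 351 * (alpha D * ell D) := by ring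
  have hX1 : X ≤ 1 := by
    have hαℓ : alpha D * ell D = π / ell D ^ 8 := by
      rw [hα]; field_simp
    have h8 : (5 : ℝ) ^ 8 ≤ ell D ^ 8 := by gcongr
    have hπ4 : π ≤ 4 := Real.pi_lt_four.le
    calc X ≤ 210 * 351 * (alpha D * ell D) := hXle
      _ = 210 * 351 * π / ell D ^ 8 := by rw [hαℓ]; ring
      _ ≤ 210 * 351 * 4 / (5 : ℝ) ^ 8 := by gcongr
      _ ≤ 1 := by norm_num
  have hexp : ∏ q ∈ S, (1 + ‖r q‖) - 1 ≤ 2 * X := by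
    have h1 := prod_one_add_le_exp_sum S (fun q => ‖r q‖) fun q _ => norm_nonneg _
    have h2 : |Real.exp X - 1| ≤ 2 * |X| := Real.abs_exp_sub_one_le (by rw [abs_of_nonneg hX0]; exact hX1)
    rw [abs_of_nonneg hX0, abs_le] at h2
    linarith [h2.2]
  calc _ ≤ ∏ q ∈ S, (1 + ‖r q‖) - 1 := key
    _ ≤ 2 * X := hexp
    _ ≤ 2 * (210 * 351 * (alpha D * ell D)) := by gcongr
    _ = 147420 * (alpha D * ell D) := by ring

/-- **`Z22:§8.u047`, global form, DISCHARGED** (with `α₁ ↦ α𝓛` as typed; constant `147420`, any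
`c′`): "`λ₀ⱼ(n) = φ(n)²/n² + O(α₁)` for `n < P`". [cite: Zhang2022LandauSiegel, §8 p.48 display before (8.11), tex L2459] -/
theorem step8u047_holds (c' : ℝ) : Section8cStatements.Step8u047 c' := by
  refine ⟨147420, ⌈Real.exp (π * |c'| + 5)⌉₊, fun D _ χ hD _ _ j _ n hn hnP => ?_⟩
  obtain ⟨hL5, _, hsmall⟩ := large_D hD
  exact norm_lamZero_sub_totient_sq_le hsmall hL5 hn hnP j

variable (c' : ℝ) in
/-- `Step8u047` — `_holds` alias of `step8u047_holds` above under the fact's exact name, stated under the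
prover's own binders as section variables (appended 2026-08-28, D-0026 bookkeeping: the proof term is the
existing theorem of this file; no statement, definition or attribute is edited; no new named fact; the
ledger's debt table listed the fact unproved). [cite: Zhang2022LandauSiegel, §8 p.48 display before (8.11), tex L2459] -/
theorem _root_.Literature.NumberTheory.LFunctions.Zhang2022.Section8cStatements.Step8u047_holds :
    _root_.Literature.NumberTheory.LFunctions.Zhang2022.Section8cStatements.Step8u047 c' :=
  _root_.Literature.NumberTheory.LFunctions.Zhang2022.Section8cProofs.step8u047_holds (c' := c')



/-! ## The relative form: `λ₀ⱼ(n) = (φ(n)/n)²(1 + O(α𝓛))` -/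

/-- **Relative form of `Z22:§8.u047`**: for `|c′|α𝓛 ≤ 1`, `𝓛 ≥ 6`, `1 ≤ n < P` and any `j`,
`‖λ₀ⱼ(n) − (φ(n)/n)²‖ ≤ 589680 · α𝓛 · (φ(n)/n)²` — so `λ₀ⱼ(n)/φ(n) = (φ(n)/n²)(1 + O(α𝓛))`, the
form the partial integration (8.11) consumes (error weight `≪ α𝓛/n`). Same proof as the absolute
form, normalising each local factor by `(1 − q⁻¹)² ≥ 1/4`.
[cite: Zhang2022LandauSiegel, §8 p.48 display before (8.11), tex L2459] -/
theorem norm_lamZero_sub_totient_sq_le_rel {c' : ℝ} {D n : ℕ} (h : |c'| * alpha D * ell D ≤ 1)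
    (hL : 6 ≤ ell D) (hn : 1 ≤ n) (hnP : (n : ℝ) < bigP D) (j : ℕ) :
    ‖lamZero c' D j n - ((Nat.totient n : ℂ) / (n : ℂ)) ^ 2‖ ≤
      589680 * (alpha D * ell D) * ((Nat.totient n : ℝ) / n) ^ 2 := by
  have hα : alpha D = π / ell D ^ 9 := by rw [alpha, bigP, Real.log_exp]
  have hL5 : 5 ≤ ell D := by linarith
  have hL0 : 0 < ell D := by linarith
  have hαpos : 0 < alpha D := by rw [hα]; positivity
  have hℓ : 0 ≤ ell D := hL0.le
  have hn0 : n ≠ 0 := by omega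
  -- real local factors `mr q = (1 − q⁻¹)²` and their product `(φ(n)/n)²`
  set S := n.primeFactors with hS
  set mr : ℕ → ℝ := fun q => (1 - (q : ℝ)⁻¹) ^ 2 with hmr
  have hmr_pos : ∀ q ∈ S, (1 : ℝ) / 4 ≤ mr q := by
    intro q hq
    have hq2 : (2 : ℝ) ≤ q := by exact_mod_cast (Nat.prime_of_mem_primeFactors hq).two_le
    have : (1 : ℝ) / 2 ≤ 1 - (q : ℝ)⁻¹ := by
      rw [inv_eq_one_div]
      have := one_div_le_one_div_of_le (by norm_num : (0:ℝ) < 2) hq2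
      linarith
    rw [hmr]; nlinarith
  have hM : ∀ q ∈ S, ((mr q : ℝ) : ℂ) = (1 - (q : ℂ)⁻¹) ^ 2 := by
    intro q _; rw [hmr]; push_cast; rfl
  have hprodR : ((Nat.totient n : ℝ) / n) ^ 2 = ∏ q ∈ S, mr q := by
    rw [Literature.NumberTheory.Sieve.CoprimeTotient.totient_div_eq_prod hn0, ← Finset.prod_pow]
  have hprodC : ((Nat.totient n : ℂ) / (n : ℂ)) ^ 2 = ((∏ q ∈ S, mr q : ℝ) : ℂ) := by
    rw [← hprodR]; push_cast; rfl
  -- `ρ_q = (λ_q − m_q)/m_q`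
  set ρ : ℕ → ℂ := fun q => (lamZero c' D j q - (1 - (q : ℂ)⁻¹) ^ 2) / ((mr q : ℝ) : ℂ) with hρ
  have hfac : ∀ q ∈ S, lamZero c' D j q = ((mr q : ℝ) : ℂ) * (1 + ρ q) := by
    intro q hq
    have hm0 : ((mr q : ℝ) : ℂ) ≠ 0 := by
      have := hmr_pos q hq
      exact_mod_cast (by linarith : mr q ≠ 0)
    have e : ρ q = (lamZero c' D j q - (1 - (q : ℂ)⁻¹) ^ 2) / ((mr q : ℝ) : ℂ) := rfl
    rw [e, ← hM q hq]
    field_simp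
    ring
  have hρle : ∀ q ∈ S, ‖ρ q‖ ≤ 840 * (alpha D * Real.log q / q) := by
    intro q hq
    have hm := hmr_pos q hq
    have hm0 : 0 < mr q := by linarith
    have key := norm_lamZero_prime_sub_le h hαpos.le hℓ j (Nat.prime_of_mem_primeFactors hq)
    rw [hρ, norm_div, Complex.norm_real, Real.norm_eq_abs, abs_of_pos hm0, div_le_iff₀ hm0]
    have hx : 0 ≤ alpha D * Real.log q / q := by
      have := Real.log_natCast_nonneg q; positivity
    calc _ ≤ 210 * (alpha D * Real.log q / q) := key
      _ = 840 * (alpha D * Real.log q / q) * (1 / 4) := by ring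
      _ ≤ 840 * (alpha D * Real.log q / q) * mr q := by gcongr
  -- the product decomposition
  rw [lamZero_eq_prod_primeFactors, Finset.prod_congr rfl hfac, Finset.prod_mul_distrib, hprodC]
  have hkey := norm_prod_add_sub_prod_le S (fun _ => (1 : ℂ)) ρ (fun _ _ => by rw [norm_one])
  rw [Finset.prod_const_one] at hkey
  have hdec : (∏ q ∈ S, ((mr q : ℝ) : ℂ)) * ∏ q ∈ S, (1 + ρ q) - ((∏ q ∈ S, mr q : ℝ) : ℂ) =
      ((∏ q ∈ S, mr q : ℝ) : ℂ) * (∏ q ∈ S, (1 + ρ q) - 1) := by push_cast; ring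
  rw [hdec, norm_mul, Complex.norm_real, Real.norm_eq_abs, ← hprodR, abs_of_nonneg (by positivity)]
  -- size of `Σ‖ρ‖`
  have hB := sum_primeFactors_log_div_le hL5 hn hnP
  set X : ℝ := ∑ q ∈ S, ‖ρ q‖ with hX
  have hX0 : 0 ≤ X := Finset.sum_nonneg fun q _ => norm_nonneg _
  have hXle : X ≤ 840 * 351 * (alpha D * ell D) := by
    calc X ≤ ∑ q ∈ S, 840 * (alpha D * Real.log q / q) := Finset.sum_le_sum hρle
      _ = 840 * alpha D * ∑ q ∈ S, Real.log q / q := by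
          rw [Finset.mul_sum]
          refine Finset.sum_congr rfl fun q _ => ?_
          ring
      _ ≤ 840 * alpha D * (351 * ell D) := by gcongr
      _ = 840 * 351 * (alpha D * ell D) := by ring
  have hX1 : X ≤ 1 := by
    have hαℓ : alpha D * ell D = π / ell D ^ 8 := by
      rw [hα]; field_simp
    have h8 : (6 : ℝ) ^ 8 ≤ ell D ^ 8 := by gcongr
    have hπ4 : π ≤ 4 := Real.pi_lt_four.le
    calc X ≤ 840 * 351 * (alpha D * ell D) := hXle
      _ = 840 * 351 * π / ell D ^ 8 := by rw [hαℓ]; ring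
      _ ≤ 840 * 351 * 4 / (6 : ℝ) ^ 8 := by gcongr
      _ ≤ 1 := by norm_num
  have hexp : ∏ q ∈ S, (1 + ‖ρ q‖) - 1 ≤ 2 * X := by
    have h1 := prod_one_add_le_exp_sum S (fun q => ‖ρ q‖) fun q _ => norm_nonneg _
    have h2 : |Real.exp X - 1| ≤ 2 * |X| :=
      Real.abs_exp_sub_one_le (by rw [abs_of_nonneg hX0]; exact hX1)
    rw [abs_of_nonneg hX0, abs_le] at h2
    linarith [h2.2]
  have hφ0 : 0 ≤ ((Nat.totient n : ℝ) / n) ^ 2 := by positivity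
  calc ((Nat.totient n : ℝ) / n) ^ 2 * ‖∏ q ∈ S, (1 + ρ q) - 1‖
      ≤ ((Nat.totient n : ℝ) / n) ^ 2 * (2 * X) := by
        gcongr; exact le_trans hkey hexp
    _ ≤ ((Nat.totient n : ℝ) / n) ^ 2 * (2 * (840 * 351 * (alpha D * ell D))) := by gcongr
    _ = 589680 * (alpha D * ell D) * ((Nat.totient n : ℝ) / n) ^ 2 := by ring

end Literature.NumberTheory.LFunctions.Zhang2022.Section8cProofs
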